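import Literature.MathematicalPhysics.QuantumFieldTheory.Balaban1983to89.B8Prop6CubeMemberFlat3
import Literature.MathematicalPhysics.QuantumFieldTheory.Balaban1983to89.B8Thm4ExistsAtBdryBeta
import Literature.MathematicalPhysics.QuantumFieldTheory.Balaban1983to89.B8LeafKnitZd3CubBdryBeta

/-!
# `Balaban1983to89.B8Prop6CubeMemberFlat3BdryBeta` — [Balaban1985RegularSpaces] PROPOSITION 6 (p. 99) AT THE CONCRETE CUBE MEMBER, BACKGROUND `1`,
# MODULO the three existence BODIES at the datum — the (1.59) body IN EDITION β (averaging datum `|B₁|β` over `Λb ∪ {level-0 crossing bonds of □₀}`)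

statement-level skeleton of published theorems with citation tags; proofs where landed; nothing here is a claim about the
Yang–Mills mass gap

PDF held: `paper:balaban1985-cmp99-regular-spaces-gauge-fixing` (journal page = PDF page + 74); pp. 77, 81–82, 86–88, 94–95, 98–99.

CITATION HEADER (lean-in-tree rule).  Cell `pub-ymgap` (HUMAN RULING D-0062, Track A), DAG node N05 = [B8], seat `pub-ymgap-dag-n05-e` g8 (R141 (C)
row s3b — the FLAT LINE re-keyed to the socket of record).  WHY: g6's F12 `B8Prop6CubeMemberFlat3Bdry` (the flat line's entry) reads the (1.59) body `H59D₁`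
in the currency R-d — refuted at the cube member by the boundary pure-gauge mode (dag-n06-b CANDIDATE-3, p539131).  EDITION β (dag-lead RULING №189 (2); dag-n06-b
p541339) puts the level-0 crossing bonds of `□₀` into `|B₁|`.  THIS FILE re-runs F12 in β: ★ `prop6_exists_cubeMember_at_bdryβ₃` on
`B8Thm4ExistsAtBdryBeta` with the boundary-layer law discharged at the cube.  Kind «kernel-checked proof», theorems only, no `def`.

HONEST SCOPE.  By-name re-run; the three bodies are HYPOTHESES at the datum (the β body = [4] Thm 3.3 with exterior data in the β reading).  A6-PARTIAL: the
boundary pure-gauge mode makes the β body FALSE below an absolute threshold in `B₀` (as in print, `B₀` = [4] Thm 3.3's constant) — vacuous there, declared (ref-E g10 READ-12, STATUS S.13159, on p544795: for the two-line body the kernel threshold is `B₀ ≥ 1` at every cube member with `k ≥ 1` — certificate `RefE.G10.BdryBetaA6.beta_socket_false_of_B₀_lt_one`, evidence only).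
`B_∂`, `4B_∂ ≤ (dL − 1)B₀` are the tree's.  Count-neutral; N05 NOT discharged; one finite `𝕋⁴` programme at fixed `ε`, Bałaban as printed; nothing continuum
∕ ℝ⁴ ∕ OS ∕ mass-gap ∕ Clay.  No `sorry`, no `def`, no `instance`, no `notation`.  Unit `pub-ymgap-dag-n05-e` (g8), 2026-08-27.
-/

noncomputable section

open NormedSpace

namespace Literature.MathematicalPhysics.QuantumFieldTheory.Balaban1983to89.B8Prop6CubeMemberFlat3BdryBeta

open B7Prop1Explicit B7Prop2Explicit B7Prop1Local B7Eq92Concrete B8Ineq130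
open B7Prop2Explicit (C0 c2')
open B8Ineq132 (covDerivFwd InAk pdevOn_lt_of_inAk BondTouches)
open B8Ineq133 (cutFixed)
open B8Eq115GaugeFixing (localGauge)
open B8Eq119TwistedAxial (InAx Restr129)
open B8Eq184Proof (gaugeExp cfgExp)
open B8Lemma1NonAbelian (mulCfg)
open B8Eq140Level (SideTouches)
open B8Eq146AExpansion (iEta)
open B7Prop4GeneralLevels (linCovIter)
open B8Eq155JBound (Jcur wsup)
open B8ScaledSupNorm (bondNorm msup)
open B8Thm2LogB (blockTop)
open B8Eq138LandauZd (IsLandau138W logCfg)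
open B8Eq131Cubes (tcube tLo tHi ctr tLo_le_tHi)
open B8Eq131CubesAdmissible (cubeFam)
open B8Prop6OfThm4 (localGauge_mem agree135 smallness_134 const_136)
open B8CubeMemberZd (cubeLamS cubeLamB hΩ_cubeFam hbox_cubeLamB hclass_cubeLamB)
open B8Prop6CubeMember (thm4_hypotheses_one_cutFixed regime_of_printed_smallness)
open B8Thm4ExistsAtBdryBeta (thm4Exists_concrete_at_bdryβ)
open B8LeafKnitZd3CubBdryBeta (bdryLayer_cubeMember)
open B9SupplySockB9P3ZdBeta (CrossB)

export B7Prop1Explicit (Site)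

variable {d : ℕ}

variable {𝔸 : Type} [CStarAlgebra 𝔸] [Nontrivial 𝔸]

/-- ★ **PROPOSITION 6 (p. 99) AT THE CONCRETE CUBE MEMBER, MODULO THE THREE EXISTENCE BODIES AT THE FLAT DATUM `(1, U₀″)`, THE (1.59) BODY IN
EDITION β** — g6's `B8Prop6CubeMemberFlat3Bdry.prop6_exists_cubeMember_at_bdry₃` with its third body `H59D₁ ↦ H59Dβ₁`: the two (1.59) lines carry the β
averaging datum `|B₁|β` over `cubeLamB … m j ∪ {level-0 crossing bonds of □₀}` (the body of dag-n06-b's `SockB9P3D4β` at the datum), support clause and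
exterior-collar term as before; driver `B8Thm4ExistsAtBdryBeta.thm4Exists_concrete_at_bdryβ`, its boundary-layer law discharged at the cube by
`B8LeafKnitZd3CubBdryBeta.bdryLayer_cubeMember`; conclusion byte-identical.
[cite: Balaban1985RegularSpaces, Prop. 6 (1.135)–(1.136) p.99, p.99 (sentence after (1.133)), Thm 4 p.88 (existence), Prop. 5 (1.107)–(1.108) p.94, (1.58)–(1.59) p.86, (1.31) p.82] -/
theorem prop6_exists_cubeMember_at_bdryβ₃ (hd2 : 2 ≤ d) {L : ℕ} (hL : 2 ≤ L) {B₀ B₀' Bbd : ℝ} (hB₀ : 0 < B₀) (hB₀' : 0 < B₀')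
    (hB : 2 ≤ 5 * (d : ℝ) * L * B₀) (hBbd : 0 ≤ Bbd) (hBd : 4 * Bbd ≤ ((d : ℝ) * L - 1) * B₀) :
    ∃ c₁ : ℝ, 0 < c₁ ∧ ∀ (η : ℝ), 0 < η → ∀ (k : ℕ), 1 ≤ k → ∀ (a : Site d) (M ρ : ℕ), L ≤ ρ → ρ ≤ M → 11 * (d : ℝ) < M →
      ∀ (U₀ : Site d → Fin d → 𝔸ˣ), (∀ x κ, U₀ x κ ∈ unitaryUnits 𝔸) → ∀ (α₀ : ℝ), 0 < α₀ →
      C0 d * (α₀ * (L : ℝ) ^ 2) ≤ 1 / 3 → 2 * (α₀ * (L : ℝ) ^ 2) ≤ c2' d L →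
      ∀ (Ω : ℕ → Set (Site d)), InAk L k η α₀ Ω U₀ → tcube L a M ρ k ⊆ Ω (k - 1) →
      11 * (d : ℝ) ^ 2 * (L : ℝ) ^ 2 * α₀ + ((M : ℝ) + 4 * ρ) * d * (L : ℝ) ^ 2 * α₀ ≤ 1 / 6 →
      (L : ℝ) ^ 3 * α₀ + 6 * d * (L : ℝ) ^ 2 * M * α₀ ≤ c₁ →
      ((∃ (v : Site d → 𝔸ˣ) (lam : Site d → 𝔸), (∀ x, v x ∈ unitaryUnits 𝔸) ∧ (∀ x, x ∉ (cubeFam false L a M ρ k) 0 → v x = 1) ∧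
        (∀ j, j ≤ 1 → ∀ b ∈ {b : Site d × Fin d | SideTouches ((cubeFam false L a M ρ k) j) b.1 b.2}, (v b.1 : 𝔸) = ((gaugeExp lam b.1 : 𝔸ˣ) : 𝔸) ∧
        (v (b.1 + e b.2) : 𝔸) = ((gaugeExp lam (b.1 + e b.2) : 𝔸ˣ) : 𝔸)) ∧
        (∀ j, j ≤ 1 → ∀ b ∈ {b : Site d × Fin d | SideTouches ((cubeFam false L a M ρ k) j) b.1 b.2},
        ‖lam b.1‖ ≤ (8 * B₀' * (5 * (d : ℝ) * L * B₀) * (((L : ℝ) ^ 3 * α₀) + (6 * d * (L : ℝ) ^ 2 * M * α₀))) ∧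
          ((L : ℝ) ^ j * η) * ‖covDerivFwd η (1 : Site d → Fin d →
          𝔸ˣ) b.2 lam b.1‖ ≤ (8 * B₀' * (5 * (d : ℝ) * L * B₀) * (((L : ℝ) ^ 3 * α₀) + (6 * d * (L : ℝ) ^ 2 * M * α₀)))) ∧
        IsLandau138W L 1 η ((cubeFam false L a M ρ k) 0) ((cubeLamS L a M ρ k) 1) (1 : Site d → Fin d → 𝔸ˣ) (mgauge (1 : Site d → Fin d →
          𝔸ˣ) v⁻¹ (cutFixed L (tLo a ρ) (tHi a M ρ) U₀ k (ctr a M))) ∧ Restr129 L 1 ((cubeLamS L a M ρ k) 1) (1 : Site d → Fin d → 𝔸ˣ) ((1 : Site d →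
          𝔸ˣ) * v))) →
      ((∀ m, 1 ≤ m → m < k → ∀ (u₁ : Site d → 𝔸ˣ) (U₁ : Site d → Fin d → 𝔸ˣ) (A : Site d → Fin d → 𝔸),
        (∀ x, u₁ x ∈ unitaryUnits 𝔸) → (∀ x, x ∉ (cubeFam false L a M ρ k) 0 → u₁ x = 1) → mgauge (1 : Site d → Fin d →
          𝔸ˣ) u₁ U₁ = (cutFixed L (tLo a ρ) (tHi a M ρ) U₀ k (ctr a M)) → Restr129 L m ((cubeLamS L a M ρ k) m) (1 : Site d → Fin d → 𝔸ˣ) u₁ →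
        IsLandau138W L m η ((cubeFam false L a M ρ k) 0) ((cubeLamS L a M ρ k) m) (1 : Site d → Fin d → 𝔸ˣ) U₁ →
        (∀ j, j ≤ m → ∀ b ∈ {b : Site d × Fin d | SideTouches ((cubeFam false L a M ρ k) j) b.1 b.2},
        U₁ b.1 b.2 = cfgExp η A b.1 b.2 ∧ IsSelfAdjoint (A b.1 b.2) ∧
          ‖A b.1 b.2‖ ≤ (5 * (d : ℝ) * L * B₀ * (((L : ℝ) ^ 3 * α₀) + (6 * d * (L : ℝ) ^ 2 * M * α₀))) * ((L : ℝ) ^ j * η)⁻¹) →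
        ∃ (v : Site d → 𝔸ˣ) (lam : Site d → 𝔸), (∀ x, v x ∈ unitaryUnits 𝔸) ∧ (∀ x, x ∉ (cubeFam false L a M ρ k) 0 → v x = 1) ∧
        (∀ j, j ≤ m + 1 →
          ∀ b ∈ {b : Site d × Fin d | SideTouches ((cubeFam false L a M ρ k) j) b.1 b.2}, (v b.1 : 𝔸) = ((gaugeExp lam b.1 : 𝔸ˣ) : 𝔸) ∧
        (v (b.1 + e b.2) : 𝔸) = ((gaugeExp lam (b.1 + e b.2) : 𝔸ˣ) : 𝔸)) ∧
        (∀ j, j ≤ m + 1 → ∀ b ∈ {b : Site d × Fin d | SideTouches ((cubeFam false L a M ρ k) j) b.1 b.2},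
        ‖lam b.1‖ ≤ (8 * B₀' * (5 * (d : ℝ) * L * B₀) * (((L : ℝ) ^ 3 * α₀) + (6 * d * (L : ℝ) ^ 2 * M * α₀))) ∧
          ((L : ℝ) ^ j * η) * ‖covDerivFwd η (1 : Site d → Fin d →
          𝔸ˣ) b.2 lam b.1‖ ≤ (8 * B₀' * (5 * (d : ℝ) * L * B₀) * (((L : ℝ) ^ 3 * α₀) + (6 * d * (L : ℝ) ^ 2 * M * α₀)))) ∧
        IsLandau138W L (m + 1) η ((cubeFam false L a M ρ k) 0) ((cubeLamS L a M ρ k) (m + 1)) (1 : Site d → Fin d → 𝔸ˣ) (mgauge (1 : Site d → Fin d →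
          𝔸ˣ) v⁻¹ U₁) ∧ Restr129 L (m + 1) ((cubeLamS L a M ρ k) (m + 1)) (1 : Site d → Fin d → 𝔸ˣ) (u₁ * v))) →
      ((∀ m, 1 ≤ m → m ≤ k → ∀ (u : Site d → 𝔸ˣ) (W : Site d → Fin d → 𝔸ˣ) (A' : Site d → Fin d → 𝔸),
        (∀ x, u x ∈ unitaryUnits 𝔸) → (∀ x, x ∉ (cubeFam false L a M ρ k) 0 → u x = 1) →
          mgauge (1 : Site d → Fin d → 𝔸ˣ) u W = (cutFixed L (tLo a ρ) (tHi a M ρ) U₀ k (ctr a M)) →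
          Restr129 L m ((cubeLamS L a M ρ k) m) (1 : Site d → Fin d → 𝔸ˣ) u →
          IsLandau138W L m η ((cubeFam false L a M ρ k) 0) ((cubeLamS L a M ρ k) m) (1 : Site d → Fin d → 𝔸ˣ) W →
        (∀ y τ, IsSelfAdjoint (A' y τ)) →
        (∀ j, j ≤ m → ∀ y τ, SideTouches ((cubeFam false L a M ρ k) j) y τ →
        W y τ = cfgExp η A' y τ ∧
          ‖A' y τ‖ ≤ (2 * (L * (5 * (d : ℝ) * L * B₀ * (((L : ℝ) ^ 3 * α₀) + (6 * d * (L : ℝ) ^ 2 * M * α₀)))) + 8 * (8 * B₀' * (5 * (d : ℝ) * L * B₀) * (((L : ℝ) ^ 3 * α₀) + (6 * d * (L : ℝ) ^ 2 * M * α₀)))) * ((L : ℝ) ^ j * η)⁻¹) →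
        (∀ y τ, (∀ j, j ≤ m → ¬ SideTouches ((cubeFam false L a M ρ k) j) y τ) → A' y τ = 0) →
        msup L m η (-(1 : ℝ)) (fun j (b : Site d × Fin d) => SideTouches ((cubeFam false L a M ρ k) j) b.1 b.2) (fun b => A' b.1 b.2)
        ≤ B₀ * (bondNorm L m η (-(3 : ℝ)) (cubeFam false L a M ρ k) (fun x μ => Jcur η (1 : Site d → Fin d → 𝔸ˣ) A' μ x)
        + wsup 1 (fun p : {p : ℕ × (Site d × Fin d) // p.1 ≤ m ∧ (p.2 ∈ (cubeLamB L a M ρ k) m p.1 ∨ (p.1 = 0 ∧ CrossB ((cubeFam false L a M ρ k) 0) p.2))} =>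
        linCovIter L (1 : Site d → Fin d → 𝔸ˣ) (iEta η A') p.1.1 p.1.2.1 p.1.2.2))
        + Bbd * msup L m η (-(1 : ℝ)) (fun j (b : Site d × Fin d) => j = 0 ∧ SideTouches ((cubeFam false L a M ρ k) 0) b.1 b.2 ∧
            ¬ BondTouches ((cubeFam false L a M ρ k) 0) b.1 b.2) (fun b => A' b.1 b.2) ∧
        msup L m η (-(2 : ℝ)) (fun j (t : Fin d × Fin d × Site d) => SideTouches ((cubeFam false L a M ρ k) j) t.2.2 t.2.1)
        (fun t => covDerivFwd η (1 : Site d → Fin d → 𝔸ˣ) t.1 (fun z => A' z t.2.1) t.2.2)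
        ≤ B₀ * (bondNorm L m η (-(3 : ℝ)) (cubeFam false L a M ρ k) (fun x μ => Jcur η (1 : Site d → Fin d → 𝔸ˣ) A' μ x)
        + wsup 1 (fun p : {p : ℕ × (Site d × Fin d) // p.1 ≤ m ∧ (p.2 ∈ (cubeLamB L a M ρ k) m p.1 ∨ (p.1 = 0 ∧ CrossB ((cubeFam false L a M ρ k) 0) p.2))} =>
        linCovIter L (1 : Site d → Fin d → 𝔸ˣ) (iEta η A') p.1.1 p.1.2.1 p.1.2.2))
        + Bbd * msup L m η (-(1 : ℝ)) (fun j (b : Site d × Fin d) => j = 0 ∧ SideTouches ((cubeFam false L a M ρ k) 0) b.1 b.2 ∧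
            ¬ BondTouches ((cubeFam false L a M ρ k) 0) b.1 b.2) (fun b => A' b.1 b.2))) →
      ∃ u : Site d → 𝔸ˣ, (∀ x, u x ∈ unitaryUnits 𝔸) ∧ (∀ x, x ∉ cubeFam false L a M ρ k 0 → u x = 1) ∧
        Restr129 L k (cubeLamS L a M ρ k k) (1 : Site d → Fin d → 𝔸ˣ) u ∧
        IsLandau138W L k η (cubeFam false L a M ρ k 0) (cubeLamS L a M ρ k k) (1 : Site d → Fin d → 𝔸ˣ)
          (gaugeAct u⁻¹ (cutFixed L (tLo a ρ) (tHi a M ρ) U₀ k (ctr a M))) ∧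
        (∀ j, j ≤ k → ∀ b ∈ {b : Site d × Fin d | SideTouches (cubeFam false L a M ρ k j) b.1 b.2},
          gaugeAct u⁻¹ (cutFixed L (tLo a ρ) (tHi a M ρ) U₀ k (ctr a M)) b.1 b.2 =
              cfgExp η (logCfg η (gaugeAct u⁻¹ (cutFixed L (tLo a ρ) (tHi a M ρ) U₀ k (ctr a M)))) b.1 b.2 ∧
            IsSelfAdjoint (logCfg η (gaugeAct u⁻¹ (cutFixed L (tLo a ρ) (tHi a M ρ) U₀ k (ctr a M))) b.1 b.2) ∧
            ‖logCfg η (gaugeAct u⁻¹ (cutFixed L (tLo a ρ) (tHi a M ρ) U₀ k (ctr a M))) b.1 b.2‖ ≤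
              (5 * (d : ℝ) * L * B₀ * ((L : ℝ) ^ 3 * α₀ + 6 * d * (L : ℝ) ^ 2 * M * α₀)) * ((L : ℝ) ^ j * η)⁻¹) ∧
        (∀ x, ((localGauge L (tLo a ρ) (tHi a M ρ) U₀ k (ctr a M))⁻¹ * u) x ∈ unitaryUnits 𝔸) ∧
        AgreeOn (tlo L (tLo a ρ) k) (thi L (tHi a M ρ) k)
          (gaugeAct ((localGauge L (tLo a ρ) (tHi a M ρ) U₀ k (ctr a M))⁻¹ * u)⁻¹ U₀)
          (gaugeAct u⁻¹ (cutFixed L (tLo a ρ) (tHi a M ρ) U₀ k (ctr a M))) := by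
  have hL1 : 1 ≤ L := le_trans (by norm_num) hL
  have hd1 : 1 ≤ d := le_trans (by norm_num) hd2
  obtain ⟨c₁, hc₁, H⟩ := thm4Exists_concrete_at_bdryβ (𝔸 := 𝔸) hd2 hL hB₀ hB₀' hB hBbd hBd
  refine ⟨c₁, hc₁, ?_⟩
  intro η hη k hk a M ρ hρL hρM hM U₀ hU₀ α₀ hα hα3 hα2 Ω hA hT hsmall hc P5base₁ P5step₁ H59Dβ₁
  have hρ : 1 ≤ ρ := hL1.trans hρL
  have hM1 : 1 ≤ M := hρ.trans hρM
  have hLpos : (0 : ℝ) < L := by exact_mod_cast lt_of_lt_of_le (by norm_num) hL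
  have hdpos : (0 : ℝ) < d := by exact_mod_cast hd1
  have hMpos : (0 : ℝ) < M := by exact_mod_cast hM1
  have hα₀' : 0 < (L : ℝ) ^ 3 * α₀ := by positivity
  have hα₁' : 0 < 6 * (d : ℝ) * (L : ℝ) ^ 2 * M * α₀ := by positivity
  obtain ⟨hmem, h33, h34, hAx, h135, h66⟩ :=
    thm4_hypotheses_one_cutFixed L hL hd1 k U₀ hU₀ hα hα3 hα2 a hρ hρM hM hη hA hT hsmall
  have hone : ∀ x κ, (1 : Site d → Fin d → 𝔸ˣ) x κ ∈ unitaryUnits 𝔸 := fun _ _ => (unitaryUnits 𝔸).one_mem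
  obtain ⟨u, hu, huS, h129, hLan, h162⟩ := H η hη k (cubeFam false L a M ρ k) (hΩ_cubeFam hL1 a M hρL k)
    (cubeLamS L a M ρ k) (cubeLamB L a M ρ k) (hbox_cubeLamB L a M ρ k) (hclass_cubeLamB L a M ρ k)
    (bdryLayer_cubeMember hL a M ρ k hρL hk) _ _ hα₀' hα₁' hc 1 _ hone hmem h33 h34 hAx h135 h66 P5base₁ P5step₁ H59Dβ₁
  simp only [mgauge_one_left] at hLan h162
  have hΩ' : ∃ l, l ≤ k ∧ k ≤ l + 1 ∧ ∀ x, InBox (tlo L (tLo a ρ) k) (thi L (tHi a M ρ) k) x → x ∈ Ω l :=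
    ⟨k - 1, Nat.sub_le _ _, by omega, fun x hx => hT hx⟩
  have hvG : ∀ x, localGauge L (tLo a ρ) (tHi a M ρ) U₀ k (ctr a M) x ∈ unitaryUnits 𝔸 :=
    localGauge_mem L hL (avgClosed_unitaryUnits (𝔸 := 𝔸) d L) k U₀ hU₀ hα hα3 hα2 (tLo_le_tHi hM1)
      (pdevOn_lt_of_inAk hL1 hα hA hΩ') (ctr a M)
  exact ⟨u, hu, huS, h129, hLan hk, h162, fun x => (unitaryUnits 𝔸).mul_mem ((unitaryUnits 𝔸).inv_mem (hvG x)) (hu x),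
    agree135 _ _ U₀ _ u⟩

#print axioms prop6_exists_cubeMember_at_bdryβ₃

end Literature.MathematicalPhysics.QuantumFieldTheory.Balaban1983to89.B8Prop6CubeMemberFlat3BdryBeta

end

/-! ## HONEST SCOPE — VACUOUS AS TYPED (2026-08-27, seat `pub-ymgap-dag-n05-e` g9; director-ym LINE №196, dag-lead DEDUP-349∕350)

Every theorem of this file whose hypotheses contain a (1.59)-type clause or socket in EDITION β at a CUBE MEMBER of (1.131) — the SCALAR clauses
SC2∕SC4, the 𝔸-valued sockets `SockB9P3D4β` ∕ `H59Dβ` ∕ the four-line Prop.-3-frame socket, or a hypothesis SET that yields them (`B9.Thm33Printed` +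
dag-n06-b's member-local binders at every truncation) — is VACUOUS AS TYPED: the averaging datum is read over `B8CubeMemberZd.cubeLamB`, whose condition 1
«fine box ⊂ □_j» EMPTIES print's crossing bonds of (1.31) at levels `j ≥ 1`, and the interior SHELL GAUGE MODES `∂(𝟙λ)`, `λ ⊂ □_j`, then defeat the clause at
every cube member with `k ≥ 1` for ALL constants `B₀, B_∂` — KERNEL CERTIFICATE dag-n05-c `B8Ineq159FlatShellModeVacuity` (p572834:
`not_flat159β_two_cubeMember(_one)`, `sc2_uninhabited_cubeB8`; ref-E g12 READ-11 A6-FINAL), `Ω₀ = ℤᵈ` twin `…ShellModeVacuityUniv` (p576185).  The theorems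
stay TRUE and PASS-AS-DECLARED; their content at cube members is nil.  Nothing of [Balaban1985RegularSpaces] is refuted: print's class ([B6] (2.3), «at least
one end-point in Ω_j^{(j)}») contains the crossing bonds and kills the modes (dag-n05-c `B8Ineq159FlatShellModeCrossingDatum`).  SUPERSEDED BY EDITION γ: the
datum class of record becomes dag-n05-c's `B8Ineq159FlatCubeMemberPrinted.cubeLamBP` (p573921∕p575549), the socket dag-n06-b's `B9SupplySockB9P3ZdGamma`, the
Theorem-4 driver this seat's `B8Eq142KLevelLocalGamma` ∕ `B8Thm4KLevelGamma`; this file is kept as history and for its class-independent mechanics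
(composition shape, ⊗-id transfer, the level-0 crossing MOVE), re-run by token swap in γ.  Count-neutral; N05 NOT discharged; nothing continuum ∕ ℝ⁴ ∕ OS ∕
mass-gap ∕ Clay. -/
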